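import Summits.QuantumFields.YangMills.Theorems.BalabanUVNodesN07CentralResponseOnto
import Summits.QuantumFields.YangMills.Theorems.BalabanUVNodesN07AveragingLocalContinuity
import Literature.MathematicalPhysics.QuantumFieldTheory.Balaban1983to89.FieldMeasureExpChartChangeOfVariables
import Literature.MathematicalPhysics.QuantumFieldTheory.Balaban1983to89.HaarExpChartLocalFaceTransport
import Mathlib.Analysis.LocallyConvex.HahnBanach
import HarnessLib

/-!
# BalabanUVNodes ∕ N09 — (M3r)-LOCAL, FILE 1∕2: THE CHART-READ (0.4) EML BLOCK AVERAGE `ψ_{U₀} : A ↦ (c ↦ Λ(Ū(Θ^B(A)·U₀)(c)·Ū(U₀)(c)⁻¹))` IS `C^∞` AT `0` ON THE GUARD,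
# MEASURABLE, AND ITS DERIVATIVE ALONG ONE-BOND CHART RAYS IS THE RESPONSE OF THE MATRIX EXTENSION `avgM` (file 2: ONTO ⇒ submersion ⇒ local Jacobian face ⇒ continuous density)

Cell `pub-ymgap`, width seat `pub-ymgap-dag-n09-w4` generation 5 (HUMAN RULING D-0149; DAG node N09 = [Balaban1987RG1] §§2–5; INBOX CLAIM-1∕INTENT-1 l.32428).
`--kind proof --supports stmt-QuantumFields-26907 --as helper` (K1⁸; count-neutral; theorems only, 0 def ∕ 0 instance ∕ 0 notation ∕ 0 sorry).

WHY.  On the LOCAL ROUTE to N09's analytic inclusion `hreg` (dag-n09-w2 g3∕g4: flat engines `SubmersionPushforwardDensity` p610570 ∕ `AnalyticSubmersionSharpDensity` →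
chart transport `HaarExpChartLocalFaceTransport` → gluing `PushforwardDensityGluing` → `Node00.RegSetOfFibredChart`) the ONE non-bookkeeping input per fine configuration `U₀` was
located as UNOWNED (INBOX l.32142, l.32405; dag-n09-w6 `F1-CONSUMER-MAP.md` §3; this seat's g4 `N09-HAAR-SIDE-GLUE.md` §2): **(M3r)-local — the chart-read averaging `ψ_{U₀}`
(`Θ`, `Λ` = p28's exponential ∕ logarithmic charts of `SU(N)`, `isChartRep_specialUnitaryGroup`; `Ū = avgFun expMeanLogSU = (avOfRecord F N K k).avg`) is `C¹` at `0` with ONTO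
differential** — the inputs `Measurable ψ`, `ContDiffAt ℝ 1 ψ 0`, `range (fderiv ℝ ψ 0) = ⊤` of the engine.  THIS FILE: measurability, smoothness, and the derivative brick.

CONTENTS (CONSUMED BY NAME, nothing modified: `Node00.AveragingSmooth` — `avgM`, `coeField`, `contDiffAt_avgM_coeField`, `coe_avgFun_of_small`, `coe_loopHol`, `contDiff_loopM`,
`norm_loopM_coeField_sub_one_lt`; p28 `HaarExponentialChart` — `rho_expChart`, `coe_logChart`, `expChart_zero`, `innerRadius_pos`, `continuous_expChart`; dag-n09-w2's
`HaarExpChartLocalFaceTransport.measurable_logChart`; dag-n07-w2∕n07-e's `…N07AveragingLocalContinuity.continuousAt_avgFun_apply_of_small`; `MatrixLog.analyticAt_mlog`,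
`B7TransferAnalyticMean.hasFDerivAt_mlog_one`; Mathlib `Submodule.ClosedComplemented.of_finiteDimensional`, `hasDerivAt_exp_smul_const`).
* §1 generic: `contDiffAt_of_coe` (a map valued in a finite-dimensional subspace is `C^n` iff its ambient coercion is — continuous linear retraction), `coe_fderiv_apply_eq`,
  `hasDerivAt_along_ray`, `tendsto_ray_nhds_zero`.
* §2 ★★ `contDiffAt_chartRead_avgFun` (`C^∞` at `0` for `∀ c, Small expMeanLogSU U₀ c`): near `0` the matrix of the `c`-component IS `log(avgM(e^{A}·↑U₀)(c)·↑Ū(U₀)(c)⋆)`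
  (`coe_chartRead_eventuallyEq`; the guard is open along the chart, `eventually_small_piExpChart_translate`); `measurable_chartRead_avgFun`; `continuousAt_avgFun_of_small`.
* §3 ★ `hasDerivAt_model_ray`: along the one-bond ray `t ↦ t·X δ_β` (= the update `U₀[β ↦ Θ(tX)·U₀(β)]`, `piExpChart_translate_smul_single`; bond velocities `X·↑U₀(β)·δ_β`,
  `hasDerivAt_coeField_piExpChart_translate_single`) the model has velocity `D(W ↦ avgM W c)(↑U₀)[X·↑U₀(β)·δ_β]·↑Ū(U₀)(c)⋆` (`D log(1) = id`).

HONEST FRAMING.  LOCATED, count-neutral kernel calculus on the tree's OWN (0.4) averaging; NO chart of Bałaban's is constructed ((2.10)'s `B′ = B − hD̃(B)` untouched), NO estimate;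
`hreg`∕`contTOn`∕`regSet`∕`TcanOfRecord` NOT discharged; N09 NOT discharged; conjunct 1 (Lemma 4) ∕ FLAG №7 untouched; K0⁷ ∕ K1⁸ ∕ K3⁷ NOT closed; counts unmoved (typed 28∕28 ·
discharged 5∕28); no summit statement is proved here; R4 = the conditional finite-𝕋⁴ rung `BalabanLadder.UV` only — NOT continuum ∕ ℝ⁴ ∕ OS; the Yang–Mills mass gap (Clay) is
NOT proved by any of this.
-/

noncomputable section

open scoped Matrix.Norms.L2Operator Topology ENNReal
open Filter Set Function MeasureTheory

namespace Summit.QuantumFields.YangMills.BalabanUVNodes.N09ChartReadAveragingSmooth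

open Literature.MathematicalPhysics.QuantumFieldTheory.Balaban1983to89
open Literature.MathematicalPhysics.QuantumFieldTheory.Balaban1983to89.HaarExponentialChart
open Literature.MathematicalPhysics.QuantumFieldTheory.Balaban1983to89.HaarExponentialChart.IsChartRep
open Literature.MathematicalPhysics.QuantumFieldTheory.Balaban1983to89.BlockAveraging (Small Idx avgFun loopHol)
open Literature.MathematicalPhysics.QuantumFieldTheory.Balaban1983to89.BlockAveragingHaarAC (centralBond IsCentral openHol pre post isLocal_avgFun)
open Literature.MathematicalPhysics.QuantumFieldTheory.Balaban1983to89.ExpMeanLog (expMeanLogSU deltaSU)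
open Literature.MathematicalPhysics.QuantumFieldTheory.Balaban1983to89.Node00
open Literature.MathematicalPhysics.QuantumLattice (fundamentalRep fundamentalRep_apply)
open MatrixLog (mlog analyticAt_mlog mlog_one)

/-! ## §1  Calculus of maps valued in a finite-dimensional subspace, through their ambient values -/

section Subspace

variable {E F : Type*} [NormedAddCommGroup E] [NormedSpace ℝ E] [NormedAddCommGroup F] [NormedSpace ℝ F]

/-- A map with values in a finite-dimensional subspace `p ⊆ F` is `C^n` at a point as soon as its ambient-valued coercion is: `p` is
complemented by a continuous linear retraction `π : F → p` (Hahn–Banach in finite dimension), and `f = π ∘ (↑ ∘ f)`. [folklore] -/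
theorem contDiffAt_of_coe (p : Submodule ℝ F) [FiniteDimensional ℝ p] {f : E → p} {a : E} {n : WithTop ℕ∞}
    (hf : ContDiffAt ℝ n (fun x => (f x : F)) a) : ContDiffAt ℝ n f a := by
  obtain ⟨π, hπ⟩ := Submodule.ClosedComplemented.of_finiteDimensional p
  have hfe : f = fun x => π ((f x : F)) := funext fun x => (hπ (f x)).symm
  rw [hfe]
  exact π.contDiff.contDiffAt.comp a hf

/-- For a map `f` valued in a subspace and differentiable at `a`, the derivative of the ambient-valued coercion is the coercion of the
derivative: `↑(Df(a) v) = D(↑∘f)(a) v`. [folklore] -/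
theorem coe_fderiv_apply_eq (p : Submodule ℝ F) {f : E → p} {a : E} (hf : DifferentiableAt ℝ f a) (v : E) :
    ((fderiv ℝ f a v : p) : F) = fderiv ℝ (fun x => (f x : F)) a v := by
  have h := (p.subtypeL.hasFDerivAt.comp a hf.hasFDerivAt).fderiv
  rw [show (fun x => (f x : F)) = (p.subtypeL : p → F) ∘ f from rfl, h]
  rfl

/-- The derivative of a differentiable map along the ray `t ↦ t·a` at `t = 0` is `Df(0) a`. [folklore] -/
theorem hasDerivAt_along_ray {f : E → F} (hf : DifferentiableAt ℝ f 0) (a : E) :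
    HasDerivAt (fun t : ℝ => f (t • a)) (fderiv ℝ f 0 a) 0 := by
  have hr : HasDerivAt (fun t : ℝ => t • a) a 0 := ((hasDerivAt_id' (0 : ℝ)).smul_const a).congr_deriv (one_smul ℝ a)
  exact hf.hasFDerivAt.comp_hasDerivAt_of_eq (0 : ℝ) hr (by rw [zero_smul])

/-- The ray `t ↦ t·a` tends to `0` as `t → 0`. [folklore] -/
theorem tendsto_ray_nhds_zero (a : E) : Tendsto (fun t : ℝ => t • a) (𝓝 0) (𝓝 0) := by
  have hcont : Continuous fun t : ℝ => t • a := continuous_id.smul continuous_const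
  simpa using hcont.tendsto 0

end Subspace

/-! ## §2  The chart-read one-step average `ψ_{U₀}(A)(c) = Λ(Ū(Θ^B(A)·U₀)(c)·Ū(U₀)(c)⁻¹)` is `C^∞` at `0` on the guard -/

section Smooth

variable {P : Params} {j : ℕ} {N : ℕ} [NeZero N]

/-- The matrix of a chart point: `↑(Θ X) = e^X`. [cite: Helgason2000, Ch. I §1 Thm. 1.14 (13) p. 96 (bookkeeping)] -/
theorem coe_expChart (X : (specialUnitaryLogChart (Fin N)).lie) :
    (((isChartRep_specialUnitaryGroup (n := Fin N)).expChart X : SU N) : Matrix (Fin N) (Fin N) ℂ) =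
      NormedSpace.exp ((X : Matrix (Fin N) (Fin N) ℂ)) := by
  have h := (isChartRep_specialUnitaryGroup (n := Fin N)).rho_expChart X
  rwa [fundamentalRep_apply] at h


variable (U₀ : GaugeField P j (SU N))

/-- The bond matrices of the translated chart point `Θ^B(A)·U₀`: `b ↦ e^{A_b}·U₀(b)`. [cite: Helgason2000, Ch. I §1 Thm. 1.14 (13) p. 96 (bookkeeping)] -/
theorem coeField_piExpChart_translate (A : PBond P j → (specialUnitaryLogChart (Fin N)).lie) :
    coeField (fun b => (isChartRep_specialUnitaryGroup (n := Fin N)).expChart (A b) * U₀ b) =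
      fun b => NormedSpace.exp (((A b : (specialUnitaryLogChart (Fin N)).lie) : Matrix (Fin N) (Fin N) ℂ)) *
        ((U₀ b : SU N) : Matrix (Fin N) (Fin N) ℂ) := by
  funext b
  show (((isChartRep_specialUnitaryGroup (n := Fin N)).expChart (A b) * U₀ b : SU N) : Matrix (Fin N) (Fin N) ℂ) = _
  rw [Submonoid.coe_mul, coe_expChart]

/-- The translated product chart is centred at `U₀`: `Θ^B(0)·U₀ = U₀`. [cite: Helgason2000, Ch. I §1 Thm. 1.14 (13) p. 96 (bookkeeping)] -/
theorem piExpChart_translate_zero :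
    (fun b => (isChartRep_specialUnitaryGroup (n := Fin N)).expChart ((0 : PBond P j → (specialUnitaryLogChart (Fin N)).lie) b) * U₀ b) = U₀ := by
  funext b
  rw [Pi.zero_apply, (isChartRep_specialUnitaryGroup (n := Fin N)).expChart_zero, one_mul]

/-- `A ↦ (b ↦ e^{A_b}·U₀(b))` is `C^∞` (bond-wise: the entire `exp` of the inclusion `𝔰𝔲(N) ⊂ M_N(ℂ)`, times a constant).
[cite: Balaban1987RG1, p.253 («analytic function»; bookkeeping)] -/
theorem contDiff_coeField_piExpChart_translate :
    ContDiff ℝ ⊤ (fun A : PBond P j → (specialUnitaryLogChart (Fin N)).lie =>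
      coeField (fun b => (isChartRep_specialUnitaryGroup (n := Fin N)).expChart (A b) * U₀ b)) := by
  have hfun : (fun A : PBond P j → (specialUnitaryLogChart (Fin N)).lie =>
      coeField (fun b => (isChartRep_specialUnitaryGroup (n := Fin N)).expChart (A b) * U₀ b)) =
      fun A b => NormedSpace.exp (((A b : (specialUnitaryLogChart (Fin N)).lie) : Matrix (Fin N) (Fin N) ℂ)) *
        ((U₀ b : SU N) : Matrix (Fin N) (Fin N) ℂ) := funext fun A => coeField_piExpChart_translate U₀ A
  rw [hfun]
  refine contDiff_pi.2 fun b => ?_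
  have hval : ContDiff ℝ ⊤ (fun A : PBond P j → (specialUnitaryLogChart (Fin N)).lie =>
      ((A b : (specialUnitaryLogChart (Fin N)).lie) : Matrix (Fin N) (Fin N) ℂ)) :=
    ((specialUnitaryLogChart (Fin N)).lie.subtypeL.contDiff).comp (contDiff_apply ℝ ((specialUnitaryLogChart (Fin N)).lie) b)
  have hexp : ContDiff ℝ ⊤ (NormedSpace.exp : Matrix (Fin N) (Fin N) ℂ → Matrix (Fin N) (Fin N) ℂ) :=
    contDiff_iff_contDiffAt.2 fun X => ((NormedSpace.exp_analytic (𝕂 := ℂ) X).contDiffAt).restrict_scalars ℝ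
  exact (hexp.comp hval).mul contDiff_const

/-- THE GUARD IS OPEN ALONG THE CHART: if every (0.4) loop variable of `U₀` is inside the guard, so is every loop variable of `Θ^B(A)·U₀` for `A`
near `0` (finitely many loops, each continuous in `A`). [cite: Balaban1987RG1, (0.4) p.253 (bookkeeping)] -/
theorem eventually_small_piExpChart_translate (hsmall : ∀ c, Small (expMeanLogSU (n := Fin N)) U₀ c) :
    ∀ᶠ A in 𝓝 (0 : PBond P j → (specialUnitaryLogChart (Fin N)).lie),
      ∀ c, Small (expMeanLogSU (n := Fin N)) (fun b => (isChartRep_specialUnitaryGroup (n := Fin N)).expChart (A b) * U₀ b) c := by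
  have hW := contDiff_coeField_piExpChart_translate (P := P) (j := j) U₀
  have hpt : ∀ (c : PBond P (j + 1)) (i : Idx P), ∀ᶠ A in 𝓝 (0 : PBond P j → (specialUnitaryLogChart (Fin N)).lie),
      ‖loopM (coeField (fun b => (isChartRep_specialUnitaryGroup (n := Fin N)).expChart (A b) * U₀ b)) c i - 1‖ < deltaSU (Fin N) := by
    intro c i
    have hcont : Continuous fun A : PBond P j → (specialUnitaryLogChart (Fin N)).lie =>
        ‖loopM (coeField (fun b => (isChartRep_specialUnitaryGroup (n := Fin N)).expChart (A b) * U₀ b)) c i - 1‖ :=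
      continuous_norm.comp (((contDiff_loopM c i).continuous.comp hW.continuous).sub continuous_const)
    have h0 : ‖loopM (coeField (fun b => (isChartRep_specialUnitaryGroup (n := Fin N)).expChart
        ((0 : PBond P j → (specialUnitaryLogChart (Fin N)).lie) b) * U₀ b)) c i - 1‖ < deltaSU (Fin N) := by
      rw [piExpChart_translate_zero]
      exact norm_loopM_coeField_sub_one_lt U₀ c (hsmall c) i
    exact hcont.continuousAt.eventually (isOpen_Iio.mem_nhds h0)
  have hall : ∀ᶠ A in 𝓝 (0 : PBond P j → (specialUnitaryLogChart (Fin N)).lie), ∀ ci : PBond P (j + 1) × Idx P,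
      ‖loopM (coeField (fun b => (isChartRep_specialUnitaryGroup (n := Fin N)).expChart (A b) * U₀ b)) ci.1 ci.2 - 1‖ < deltaSU (Fin N) :=
    eventually_all.2 fun ci => hpt ci.1 ci.2
  refine hall.mono fun A hA c i => ?_
  show ‖((loopHol (fun b => (isChartRep_specialUnitaryGroup (n := Fin N)).expChart (A b) * U₀ b) c i : SU N) : Matrix (Fin N) (Fin N) ℂ) - 1‖ < _
  rw [coe_loopHol]
  exact hA (c, i)

/-- On the guard the matrix of the relative average `Ū(Θ^B(A)·U₀)(c)·Ū(U₀)(c)⁻¹` is the smooth model `avgM(e^{A}·↑U₀)(c)·(↑Ū(U₀)(c))⋆`.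
[cite: Balaban1987RG1, (0.4) p.253 (bookkeeping)] -/
theorem coe_relAvg_eq_of_small {A : PBond P j → (specialUnitaryLogChart (Fin N)).lie} (c : PBond P (j + 1))
    (hA : Small (expMeanLogSU (n := Fin N)) (fun b => (isChartRep_specialUnitaryGroup (n := Fin N)).expChart (A b) * U₀ b) c) :
    ((avgFun (expMeanLogSU (n := Fin N)) (fun b => (isChartRep_specialUnitaryGroup (n := Fin N)).expChart (A b) * U₀ b) c *
        (avgFun (expMeanLogSU (n := Fin N)) U₀ c)⁻¹ : SU N) : Matrix (Fin N) (Fin N) ℂ) =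
      avgM (coeField (fun b => (isChartRep_specialUnitaryGroup (n := Fin N)).expChart (A b) * U₀ b)) c *
        star ((avgFun (expMeanLogSU (n := Fin N)) U₀ c : SU N) : Matrix (Fin N) (Fin N) ℂ) := by
  rw [Submonoid.coe_mul, coe_inv_SU, coe_avgFun_of_small _ c hA]

/-- ★★ **THE CHART-READ ONE-STEP AVERAGE IS `C^∞` AT `0` ON THE GUARD.**  For every fine configuration `U₀` whose (0.4) loop variables at every coarse bond lie
inside the guard, the map `A ↦ (c ↦ Λ(Ū(Θ^B(A)·U₀)(c)·Ū(U₀)(c)⁻¹))` — Bałaban's averaging read in the bond-wise exponential charts of `SU(N)` centred at `U₀` and at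
`Ū(U₀)` — is `C^∞` at `A = 0`: near `0` its matrix is `log(avgM(e^{A}·↑U₀)(c)·↑Ū(U₀)(c)⋆)` with `avgM` the analytic matrix extension (`Node00.AveragingSmooth`), `log` analytic at `1`.
[cite: Balaban1987RG1, (0.4) p.253, p.253 («we assume that it is an analytic function»)] -/
theorem contDiffAt_chartRead_avgFun (hsmall : ∀ c, Small (expMeanLogSU (n := Fin N)) U₀ c) :
    ContDiffAt ℝ ⊤ (fun (A : PBond P j → (specialUnitaryLogChart (Fin N)).lie) (c : PBond P (j + 1)) =>
      (isChartRep_specialUnitaryGroup (n := Fin N)).logChart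
        (avgFun (expMeanLogSU (n := Fin N)) (fun b => (isChartRep_specialUnitaryGroup (n := Fin N)).expChart (A b) * U₀ b) c *
          (avgFun (expMeanLogSU (n := Fin N)) U₀ c)⁻¹)) 0 := by
  set h := isChartRep_specialUnitaryGroup (n := Fin N) with hh
  set W : (PBond P j → (specialUnitaryLogChart (Fin N)).lie) → PBond P j → Matrix (Fin N) (Fin N) ℂ :=
    fun A => coeField (fun b => h.expChart (A b) * U₀ b) with hWdef
  have hW : ContDiff ℝ ⊤ W := contDiff_coeField_piExpChart_translate (P := P) (j := j) U₀
  have hW0 : W 0 = coeField U₀ := by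
    show coeField (fun b => h.expChart ((0 : PBond P j → (specialUnitaryLogChart (Fin N)).lie) b) * U₀ b) = coeField U₀
    rw [piExpChart_translate_zero]
  have hsmallA := eventually_small_piExpChart_translate (P := P) (j := j) U₀ hsmall
  refine contDiffAt_pi.2 fun c => ?_
  refine contDiffAt_of_coe (specialUnitaryLogChart (Fin N)).lie ?_
  -- the smooth model of the `c`-component
  set s : Matrix (Fin N) (Fin N) ℂ := star ((avgFun (expMeanLogSU (n := Fin N)) U₀ c : SU N) : Matrix (Fin N) (Fin N) ℂ) with hs
  have h1 : ContDiffAt ℝ ⊤ (fun A : PBond P j → (specialUnitaryLogChart (Fin N)).lie => avgM (W A) c) 0 := by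
    have ha : ContDiffAt ℝ ⊤ (avgM : (PBond P j → Matrix (Fin N) (Fin N) ℂ) → PBond P (j + 1) → Matrix (Fin N) (Fin N) ℂ) (W 0) := by
      rw [hW0]; exact contDiffAt_avgM_coeField hsmall
    exact (contDiffAt_pi.1 (ha.comp 0 hW.contDiffAt)) c
  have h2 : ContDiffAt ℝ ⊤ (fun A : PBond P j → (specialUnitaryLogChart (Fin N)).lie => avgM (W A) c * s) 0 := h1.mul contDiffAt_const
  have hval : avgM (W 0) c * s = 1 := by
    rw [hW0, ← coe_avgFun_of_small U₀ c (hsmall c), hs, coe_mul_star_coe_SU]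
  have h3 : ContDiffAt ℝ ⊤ (mlog : Matrix (Fin N) (Fin N) ℂ → Matrix (Fin N) (Fin N) ℂ) (avgM (W 0) c * s) := by
    rw [hval]; exact ((analyticAt_mlog (by simp)).contDiffAt).restrict_scalars ℝ
  have hΦ : ContDiffAt ℝ ⊤ (fun A : PBond P j → (specialUnitaryLogChart (Fin N)).lie => mlog (avgM (W A) c * s)) 0 :=
    ContDiffAt.comp (g := (mlog : Matrix (Fin N) (Fin N) ℂ → Matrix (Fin N) (Fin N) ℂ))
      (f := fun A : PBond P j → (specialUnitaryLogChart (Fin N)).lie => avgM (W A) c * s) 0 h3 h2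
  -- near `0` the coercion of the chart-read component IS the model
  have hnear : ∀ᶠ A in 𝓝 (0 : PBond P j → (specialUnitaryLogChart (Fin N)).lie), ‖avgM (W A) c * s - 1‖ < innerRadius (specialUnitaryLogChart (Fin N)) := by
    have hc : ContinuousAt (fun A : PBond P j → (specialUnitaryLogChart (Fin N)).lie => ‖avgM (W A) c * s - 1‖) 0 :=
      continuous_norm.continuousAt.comp (h2.continuousAt.sub continuousAt_const)
    refine hc.eventually (isOpen_Iio.mem_nhds ?_)
    show ‖avgM (W 0) c * s - 1‖ < innerRadius (specialUnitaryLogChart (Fin N))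
    rw [hval, sub_self, norm_zero]; exact innerRadius_pos
  refine hΦ.congr_of_eventuallyEq ((hsmallA.and hnear).mono fun A hA => ?_)
  obtain ⟨hAsmall, hAnear⟩ := hA
  have hcoe := coe_relAvg_eq_of_small (P := P) (j := j) U₀ c (hAsmall c)
  have hρ : ‖fundamentalRep (Fin N) (avgFun (expMeanLogSU (n := Fin N)) (fun b => h.expChart (A b) * U₀ b) c *
      (avgFun (expMeanLogSU (n := Fin N)) U₀ c)⁻¹) - 1‖ < innerRadius (specialUnitaryLogChart (Fin N)) := by
    rw [fundamentalRep_apply, hcoe]; exact hAnear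
  show ((h.logChart (avgFun (expMeanLogSU (n := Fin N)) (fun b => h.expChart (A b) * U₀ b) c *
      (avgFun (expMeanLogSU (n := Fin N)) U₀ c)⁻¹) : (specialUnitaryLogChart (Fin N)).lie) : Matrix (Fin N) (Fin N) ℂ) = mlog (avgM (W A) c * s)
  rw [h.coe_logChart hρ, fundamentalRep_apply, hcoe]

end Smooth


/-! ## §3  The derivative at `0`: block-triangular on the central bonds `β(c)`, with n07-w2's ONTO central responses on the diagonal ⇒ ONTO -/

section Onto

variable {P : Params} {j : ℕ} {N : ℕ} [NeZero N]
variable (U₀ : GaugeField P j (SU N))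

/-- Near `A = 0` on the guard, the MATRIX of the `c`-component of the chart-read average is the smooth model `log(avgM(↑(Θ^B(A)·U₀))(c)·↑Ū(U₀)(c)⋆)`.
[cite: Balaban1987RG1, (0.4) p.253 (bookkeeping)] -/
theorem coe_chartRead_eventuallyEq (hsmall : ∀ c, Small (expMeanLogSU (n := Fin N)) U₀ c) (c : PBond P (j + 1)) :
    (fun A : PBond P j → (specialUnitaryLogChart (Fin N)).lie =>
      (((isChartRep_specialUnitaryGroup (n := Fin N)).logChart
        (avgFun (expMeanLogSU (n := Fin N)) (fun b => (isChartRep_specialUnitaryGroup (n := Fin N)).expChart (A b) * U₀ b) c *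
          (avgFun (expMeanLogSU (n := Fin N)) U₀ c)⁻¹) : (specialUnitaryLogChart (Fin N)).lie) : Matrix (Fin N) (Fin N) ℂ)) =ᶠ[𝓝 0]
    fun A => mlog (avgM (coeField (fun b => (isChartRep_specialUnitaryGroup (n := Fin N)).expChart (A b) * U₀ b)) c *
      star ((avgFun (expMeanLogSU (n := Fin N)) U₀ c : SU N) : Matrix (Fin N) (Fin N) ℂ)) := by
  set h := isChartRep_specialUnitaryGroup (n := Fin N) with hh
  set s : Matrix (Fin N) (Fin N) ℂ := star ((avgFun (expMeanLogSU (n := Fin N)) U₀ c : SU N) : Matrix (Fin N) (Fin N) ℂ) with hs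
  have hW : ContDiff ℝ ⊤ (fun A : PBond P j → (specialUnitaryLogChart (Fin N)).lie => coeField (fun b => h.expChart (A b) * U₀ b)) :=
    contDiff_coeField_piExpChart_translate (P := P) (j := j) U₀
  have h1 : ContinuousAt (fun A : PBond P j → (specialUnitaryLogChart (Fin N)).lie => avgM (coeField (fun b => h.expChart (A b) * U₀ b)) c * s) 0 := by
    have ha : ContDiffAt ℝ ⊤ (avgM : (PBond P j → Matrix (Fin N) (Fin N) ℂ) → PBond P (j + 1) → Matrix (Fin N) (Fin N) ℂ)
        ((fun A : PBond P j → (specialUnitaryLogChart (Fin N)).lie => coeField (fun b => h.expChart (A b) * U₀ b)) 0) := by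
      show ContDiffAt ℝ ⊤ avgM (coeField (fun b => h.expChart ((0 : PBond P j → (specialUnitaryLogChart (Fin N)).lie) b) * U₀ b))
      rw [piExpChart_translate_zero]; exact contDiffAt_avgM_coeField hsmall
    exact ((contDiffAt_pi.1 (ha.comp 0 hW.contDiffAt)) c).continuousAt.mul continuousAt_const
  have hval : avgM (coeField (fun b => h.expChart ((0 : PBond P j → (specialUnitaryLogChart (Fin N)).lie) b) * U₀ b)) c * s = 1 := by
    rw [piExpChart_translate_zero, ← coe_avgFun_of_small U₀ c (hsmall c), hs, coe_mul_star_coe_SU]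
  have hnear : ∀ᶠ A in 𝓝 (0 : PBond P j → (specialUnitaryLogChart (Fin N)).lie),
      ‖avgM (coeField (fun b => h.expChart (A b) * U₀ b)) c * s - 1‖ < innerRadius (specialUnitaryLogChart (Fin N)) := by
    have hc : ContinuousAt (fun A : PBond P j → (specialUnitaryLogChart (Fin N)).lie => ‖avgM (coeField (fun b => h.expChart (A b) * U₀ b)) c * s - 1‖) 0 :=
      continuous_norm.continuousAt.comp (h1.sub continuousAt_const)
    refine hc.eventually (isOpen_Iio.mem_nhds ?_)
    show ‖avgM (coeField (fun b => h.expChart ((0 : PBond P j → (specialUnitaryLogChart (Fin N)).lie) b) * U₀ b)) c * s - 1‖ < _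
    rw [hval, sub_self, norm_zero]; exact innerRadius_pos
  refine ((eventually_small_piExpChart_translate (P := P) (j := j) U₀ hsmall).and hnear).mono fun A hA => ?_
  obtain ⟨hAsmall, hAnear⟩ := hA
  have hcoe := coe_relAvg_eq_of_small (P := P) (j := j) U₀ c (hAsmall c)
  have hρ : ‖fundamentalRep (Fin N) (avgFun (expMeanLogSU (n := Fin N)) (fun b => h.expChart (A b) * U₀ b) c *
      (avgFun (expMeanLogSU (n := Fin N)) U₀ c)⁻¹) - 1‖ < innerRadius (specialUnitaryLogChart (Fin N)) := by
    rw [fundamentalRep_apply, hcoe]; exact hAnear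
  show ((h.logChart (avgFun (expMeanLogSU (n := Fin N)) (fun b => h.expChart (A b) * U₀ b) c *
      (avgFun (expMeanLogSU (n := Fin N)) U₀ c)⁻¹) : (specialUnitaryLogChart (Fin N)).lie) : Matrix (Fin N) (Fin N) ℂ) = mlog (avgM _ c * s)
  rw [h.coe_logChart hρ, fundamentalRep_apply, hcoe]

/-- The chart ray `t ↦ Θ^B(t·X δ_β)·U₀` is the one-bond update `U₀[β ↦ Θ(tX)·U₀(β)]` (`Θ 0 = 1` off `β`). [cite: Helgason2000, Ch. I §1 Thm. 1.14 (13) p. 96 (bookkeeping)] -/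
theorem piExpChart_translate_smul_single (β : PBond P j) (X : (specialUnitaryLogChart (Fin N)).lie) (t : ℝ) :
    (fun b => (isChartRep_specialUnitaryGroup (n := Fin N)).expChart
        ((t • (Pi.single β X : PBond P j → (specialUnitaryLogChart (Fin N)).lie)) b) * U₀ b) =
      Function.update U₀ β ((isChartRep_specialUnitaryGroup (n := Fin N)).expChart (t • X) * U₀ β) := by
  funext b
  by_cases hb : b = β
  · subst hb
    rw [Function.update_self, Pi.smul_apply, Pi.single_eq_same]
  · rw [Function.update_of_ne hb, Pi.smul_apply, Pi.single_eq_of_ne hb, smul_zero,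
      (isChartRep_specialUnitaryGroup (n := Fin N)).expChart_zero, one_mul]

/-- The bond-matrix velocities of the chart ray `t ↦ Θ^B(t·Xδ_β)·U₀` at `t = 0`: `X·↑U₀(β)` at `β`, `0` elsewhere (`d∕dt e^{tX}∣₀ = X`).
[cite: Balaban1985RegularSpaces, (1.10) p.77 (bookkeeping)] -/
theorem hasDerivAt_coeField_piExpChart_translate_single (β : PBond P j) (X : (specialUnitaryLogChart (Fin N)).lie) :
    HasDerivAt (fun t : ℝ => coeField (fun b => (isChartRep_specialUnitaryGroup (n := Fin N)).expChart
        ((t • (Pi.single β X : PBond P j → (specialUnitaryLogChart (Fin N)).lie)) b) * U₀ b))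
      (Pi.single β (((X : (specialUnitaryLogChart (Fin N)).lie) : Matrix (Fin N) (Fin N) ℂ) * ((U₀ β : SU N) : Matrix (Fin N) (Fin N) ℂ)) :
        PBond P j → Matrix (Fin N) (Fin N) ℂ) 0 := by
  have hfun : (fun t : ℝ => coeField (fun b => (isChartRep_specialUnitaryGroup (n := Fin N)).expChart
        ((t • (Pi.single β X : PBond P j → (specialUnitaryLogChart (Fin N)).lie)) b) * U₀ b)) =
      fun t b => NormedSpace.exp (t • ((((Pi.single β X : PBond P j → (specialUnitaryLogChart (Fin N)).lie)) b :
        (specialUnitaryLogChart (Fin N)).lie) : Matrix (Fin N) (Fin N) ℂ)) * ((U₀ b : SU N) : Matrix (Fin N) (Fin N) ℂ) := by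
    funext t
    rw [coeField_piExpChart_translate]
    funext b
    rw [Pi.smul_apply, Submodule.coe_smul]
  rw [hfun]
  refine hasDerivAt_pi.2 fun b => ?_
  have hexp := (hasDerivAt_exp_smul_const (𝕂 := ℝ)
    ((((Pi.single β X : PBond P j → (specialUnitaryLogChart (Fin N)).lie)) b : (specialUnitaryLogChart (Fin N)).lie) :
      Matrix (Fin N) (Fin N) ℂ) (0 : ℝ)).mul_const ((U₀ b : SU N) : Matrix (Fin N) (Fin N) ℂ)
  rw [zero_smul, NormedSpace.exp_zero, one_mul] at hexp
  by_cases hb : b = β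
  · subst hb
    rw [Pi.single_eq_same] at hexp ⊢
    rw [Pi.single_eq_same]
    exact hexp
  · simp only [Pi.single_eq_of_ne hb, ZeroMemClass.coe_zero, zero_mul] at hexp ⊢
    exact hexp

/-- ★ **THE DERIVATIVE OF A MATRIX COMPONENT ALONG A ONE-BOND CHART RAY.**  On the guard, for `A_t = t·X δ_β`: the smooth model of the `c`-component has velocity
`D(W ↦ avgM W c)(↑U₀)[X·↑U₀(β)·δ_β] · ↑Ū(U₀)(c)⋆` at `t = 0` (chain rule through `avgM` and `log` at `1`, `D log(1) = id`).
[cite: Balaban1987RG1, (0.4) p.253; Balaban1985Variational, (44) p.285] -/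
theorem hasDerivAt_model_ray (hsmall : ∀ c, Small (expMeanLogSU (n := Fin N)) U₀ c) (c : PBond P (j + 1)) (β : PBond P j)
    (X : (specialUnitaryLogChart (Fin N)).lie) :
    HasDerivAt (fun t : ℝ => mlog (avgM (coeField (fun b => (isChartRep_specialUnitaryGroup (n := Fin N)).expChart
        ((t • (Pi.single β X : PBond P j → (specialUnitaryLogChart (Fin N)).lie)) b) * U₀ b)) c *
          star ((avgFun (expMeanLogSU (n := Fin N)) U₀ c : SU N) : Matrix (Fin N) (Fin N) ℂ)))
      (fderiv ℝ (fun W : PBond P j → Matrix (Fin N) (Fin N) ℂ => avgM W c) (coeField U₀)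
          (Pi.single β (((X : (specialUnitaryLogChart (Fin N)).lie) : Matrix (Fin N) (Fin N) ℂ) * ((U₀ β : SU N) : Matrix (Fin N) (Fin N) ℂ))) *
        star ((avgFun (expMeanLogSU (n := Fin N)) U₀ c : SU N) : Matrix (Fin N) (Fin N) ℂ)) 0 := by
  set s : Matrix (Fin N) (Fin N) ℂ := star ((avgFun (expMeanLogSU (n := Fin N)) U₀ c : SU N) : Matrix (Fin N) (Fin N) ℂ) with hs
  set dir : PBond P j → Matrix (Fin N) (Fin N) ℂ :=
    Pi.single β (((X : (specialUnitaryLogChart (Fin N)).lie) : Matrix (Fin N) (Fin N) ℂ) * ((U₀ β : SU N) : Matrix (Fin N) (Fin N) ℂ)) with hdir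
  have hray := hasDerivAt_coeField_piExpChart_translate_single (P := P) (j := j) U₀ β X
  have h0 : coeField (fun b => (isChartRep_specialUnitaryGroup (n := Fin N)).expChart
      (((0 : ℝ) • (Pi.single β X : PBond P j → (specialUnitaryLogChart (Fin N)).lie)) b) * U₀ b) = coeField U₀ := by
    rw [zero_smul, piExpChart_translate_zero]
  -- through `avgM · c`
  have hdiffA : DifferentiableAt ℝ (fun W : PBond P j → Matrix (Fin N) (Fin N) ℂ => avgM W c) (coeField U₀) :=
    ((contDiffAt_pi.1 (contDiffAt_avgM_coeField hsmall)) c).differentiableAt (by simp)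
  have h1 : HasDerivAt (fun t : ℝ => avgM (coeField (fun b => (isChartRep_specialUnitaryGroup (n := Fin N)).expChart
        ((t • (Pi.single β X : PBond P j → (specialUnitaryLogChart (Fin N)).lie)) b) * U₀ b)) c)
      (fderiv ℝ (fun W : PBond P j → Matrix (Fin N) (Fin N) ℂ => avgM W c) (coeField U₀) dir) 0 :=
    hdiffA.hasFDerivAt.comp_hasDerivAt_of_eq (0 : ℝ) hray h0.symm
  have h2 := h1.mul_const s
  -- through `log` at `1`
  have hval : avgM (coeField (fun b => (isChartRep_specialUnitaryGroup (n := Fin N)).expChart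
      (((0 : ℝ) • (Pi.single β X : PBond P j → (specialUnitaryLogChart (Fin N)).lie)) b) * U₀ b)) c * s = 1 := by
    rw [h0, ← coe_avgFun_of_small U₀ c (hsmall c), hs, coe_mul_star_coe_SU]
  have hlog : HasFDerivAt (mlog : Matrix (Fin N) (Fin N) ℂ → Matrix (Fin N) (Fin N) ℂ)
      ((1 : Matrix (Fin N) (Fin N) ℂ →L[ℂ] Matrix (Fin N) (Fin N) ℂ).restrictScalars ℝ) 1 :=
    (B7TransferAnalyticMean.hasFDerivAt_mlog_one (𝔄 := Matrix (Fin N) (Fin N) ℂ)).restrictScalars ℝ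
  have h3 := hlog.comp_hasDerivAt_of_eq (0 : ℝ) h2 hval.symm
  exact h3.congr_deriv rfl

variable {U₀}

end Onto

/-! ## §3b  Measurability of the chart-read average; continuity of the averaging on the guard -/

section Meas

variable {P : Params} {j : ℕ} {N : ℕ} [NeZero N]
variable (U₀ : GaugeField P j (SU N))
variable [MeasurableSpace (specialUnitaryLogChart (Fin N)).lie] [BorelSpace (specialUnitaryLogChart (Fin N)).lie]

/-- The chart-read one-step average is Borel measurable (`Θ` continuous, the (0.4) averaging measurable — `BlockAveraging.measurable_avgFun` —, `Λ` measurable —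
n09-w2's `measurable_logChart`). [cite: Balaban1987RG1, (0.4) p.253 (bookkeeping)] -/
theorem measurable_chartRead_avgFun :
    Measurable (fun (A : PBond P j → (specialUnitaryLogChart (Fin N)).lie) (c : PBond P (j + 1)) =>
      (isChartRep_specialUnitaryGroup (n := Fin N)).logChart
        (avgFun (expMeanLogSU (n := Fin N)) (fun b => (isChartRep_specialUnitaryGroup (n := Fin N)).expChart (A b) * U₀ b) c *
          (avgFun (expMeanLogSU (n := Fin N)) U₀ c)⁻¹)) := by
  set h := isChartRep_specialUnitaryGroup (n := Fin N) with hh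
  have hΘ : Measurable (fun (A : PBond P j → (specialUnitaryLogChart (Fin N)).lie) (b : PBond P j) => h.expChart (A b) * U₀ b) :=
    measurable_pi_lambda _ fun b => (h.continuous_expChart.measurable.comp (measurable_pi_apply b)).mul_const _
  have hM : Measurable (avgFun (expMeanLogSU (n := Fin N)) : GaugeField P j (SU N) → GaugeField P (j + 1) (SU N)) :=
    BlockAveraging.measurable_avgFun _ ExpMeanLog.measurable_expMeanLogSU_E
  refine measurable_pi_lambda _ fun c => ?_
  exact h.measurable_logChart.comp (((measurable_pi_apply c).comp (hM.comp hΘ)).mul_const _)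

omit [MeasurableSpace (specialUnitaryLogChart (Fin N)).lie] [BorelSpace (specialUnitaryLogChart (Fin N)).lie] in
/-- The (0.4) averaging is continuous at every configuration of the guard (n07-w2∕n07-e: `continuousAt_avgFun_apply_of_small`, bond by bond).
[cite: Balaban1987RG1, (0.4) p.253] -/
theorem continuousAt_avgFun_of_small (hsmall : ∀ c, Small (expMeanLogSU (n := Fin N)) U₀ c) :
    ContinuousAt (avgFun (expMeanLogSU (n := Fin N)) : GaugeField P j (SU N) → GaugeField P (j + 1) (SU N)) U₀ :=
  continuousAt_pi.2 fun c => N07AveragingLocalContinuity.continuousAt_avgFun_apply_of_small c (hsmall c)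

end Meas

end Summit.QuantumFields.YangMills.BalabanUVNodes.N09ChartReadAveragingSmooth
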